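import Literature.NumberTheory.Automorphic.MirabolicEisensteinConvergence
import Literature.NumberTheory.Weil1964.AdelicSchwartzDominatedOfDecay
import Literature.Analysis.FunctionSpaces.GaussianSchwartz
import HarnessLib

/-!
# Tate's majorant at `σ > 1` for a compactly supported continuous function on `𝔸_K`:
# `∫_{𝕀_K} ‖Ψ(a)‖ ‖a‖^σ d×a < ∞` and `∫_{𝕀_K} ‖Ψ(a⁻¹)‖ ‖a‖^{−σ} d×a < ∞`

Topic `NumberTheory/Automorphic`; namespace `Literature.NumberTheory.Automorphic`. THEOREMS ONLY over accepted tree modules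
(no definition, no named fact, no instance, no notation, no `sorry`).

Tate's zeta integral `∫_{𝕀_K} Φ(a) ‖a‖^s d×a` converges absolutely for `re s > 1` and `Φ ∈ 𝒮(𝔸_K)` [Tate1967, Thm. 4.4.1 /
Lemma 4.4.3; Bump1997, Prop. 3.1.8]; the tree proves this as ★ `continuous_and_tsum_lintegral_lt_top_of_mem`
(`MirabolicEisensteinConvergence`, any `n`, the mirabolic Eisenstein majorant). This file records the elementary COROLLARY used
by the trace-formula road: a continuous function `Ψ` on `𝔸_K` with COMPACT SUPPORT is dominated by a Schwartz–Bruhat function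
(a Gaussian at the archimedean places times the indicator of a compact open box at the finite ones), hence
`a ↦ Ψ(a) ‖a‖^σ` is integrable on `𝕀_K` for every `σ > 1`, and — Haar measure on the commutative group `𝕀_K` being inversion
invariant — so is `a ↦ Ψ(a⁻¹) ‖a‖^{−σ}`.

* §1 `exists_adelicSchwartzBruhat_re_pos_on` — for a compact `C ⊆ 𝔸_K` there is `Φ₀ ∈ 𝒮(𝔸_K¹)`, real and non-negative,
  with `re Φ₀ ≥ m > 0` on `C` (★ `isStandardSchwartzBruhat_mul_indicator`, ★ `gaussianSchwartz`, ★
  `Weil1964.exists_isCompact_isOpen_superset`);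
* §2 `exists_adelicSchwartzBruhat_norm_le` — `‖Ψ x‖ ≤ re Φ₀(x)` for some `Φ₀ ∈ 𝒮(𝔸_K¹)`;
* §3 `lintegral_enorm_adelicSchwartzBruhat_mul_rpow_lt_top` — Tate's absolute convergence at `n = 1` read off ★
  (one projective point, `g = (ξ⁻¹)`): `∫⁻ ‖Φ(a)‖ ‖a‖^σ dν < ∞` for `Φ ∈ 𝒮(𝔸_K¹)`, `σ > 1`;
* §4 THE HEADS **`lintegral_enorm_mul_ideleNorm_rpow_lt_top`**, `lintegral_enorm_comp_inv_mul_ideleNorm_rpow_neg_lt_top`,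
  **`integrable_ideleNorm_rpow_smul`**, **`integrable_ideleNorm_rpow_neg_smul_comp_inv`**.

Consumer: the centre-lattice part of the unipotent term of Arthur's trace formula on `U(J₃)` (row (L5-i) (C-γ) of
`Cruxes/H413/Lines/F0_T1InnerFormTraceIdentity.lean`, cell `pub/hodgecm-mathlib`, crux H413; Rogawski1990 §7.3 (7.3.2), the
Tate integral at `s = 2` of the `K_U`-average of `f` along the centre line), where `Ψ` is that average composed with the line
dictionary ★ `UnitaryGroup.traceZeroLine` and `σ = 2`. HC_CM is proved only modulo the 7 printed citations until rung 0
closes — nothing here bears on a summit statement.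

Measurable structure: as in ★ `MirabolicEisensteinConvergence`, `𝕀_K = ideleGroup K` carries Mathlib's `Units` σ-algebra
induced from a Borel σ-algebra on `𝔸_K` (it is the Borel σ-algebra of the idele topology, ★ `borelSpace_ideleGroup`).

## References
* [CasselsFrohlichANT1967] J. Tate, *Fourier analysis in number fields and Hecke's zeta-functions*, in Cassels–Fröhlich
  (eds.), *Algebraic Number Theory* (1967), Ch. XV, Thm. 4.4.1, Lemma 4.4.3.
* [Bump1997] D. Bump, *Automorphic Forms and Representations* (1997), §3.1, Prop. 3.1.8.
* [Rogawski1990] J. D. Rogawski, *Automorphic Representations of Unitary Groups in Three Variables* (1990), §7.3 (7.3.2).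
-/

set_option autoImplicit false

noncomputable section

open MeasureTheory MeasureTheory.Measure NumberField IsDedekindDomain Set Filter Matrix
open scoped ENNReal NNReal Topology

namespace Literature.NumberTheory.Automorphic

variable (K : Type) [Field K] [NumberField K]

/-! ## §1 A real non-negative Schwartz–Bruhat function bounded below on a compact set -/

/-- **A Schwartz–Bruhat minorant of a compact set.** For every compact `C ⊆ 𝔸_K` there is a standard Schwartz–Bruhat
function `Φ₀ ∈ 𝒮(𝔸_K¹)` (Gaussians at the archimedean places, the indicator of a compact open box `U ⊇ C_f` at the finite
ones) which is REAL and NON-NEGATIVE everywhere and bounded below by some `m > 0` on `C` (read through `x ↦ (x)`, the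
one-coordinate vector). [cite: Bump1997, §3.1] [cite: CasselsFrohlichANT1967, Ch. XV §4.4] -/
theorem exists_adelicSchwartzBruhat_re_pos_on {C : Set (AdeleRing (𝓞 K) K)} (hC : IsCompact C) :
    ∃ Φ₀ : (Fin 1 → AdeleRing (𝓞 K) K) → ℂ, Φ₀ ∈ adelicSchwartzBruhat K 1 ∧
      (∀ x, (Φ₀ x).im = 0 ∧ 0 ≤ (Φ₀ x).re) ∧
      ∃ m : ℝ, 0 < m ∧ ∀ x ∈ C, m ≤ (Φ₀ fun _ => x).re := by
  classical
  -- the finite part: a compact open box containing the finite parts of `C`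
  have hCf : IsCompact ((fun x : AdeleRing (𝓞 K) K => vecFinitePart K 1 fun _ : Fin 1 => x) '' C) :=
    hC.image ((continuous_vecFinitePart K).comp (continuous_pi fun _ => continuous_id))
  obtain ⟨U, hUc, hUo, hCU⟩ := Literature.NumberTheory.Weil1964.exists_isCompact_isOpen_superset K hCf
  haveI : T2Space (FiniteAdeleRing (𝓞 K) K) := inferInstanceAs <| T2Space
    (RestrictedProduct (fun v : HeightOneSpectrum (𝓞 K) => v.adicCompletion K)
      (fun v => (v.adicCompletionIntegers K : Set (v.adicCompletion K))) Filter.cofinite)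
  have hUcl : IsClopen U := ⟨hUc.isClosed, hUo⟩
  -- the archimedean part: Gaussians
  set Gr : SchwartzMap (Fin 1 → ℝ) ℂ :=
    SchwartzMap.compCLMOfContinuousLinearEquiv ℝ (EuclideanSpace.equiv (Fin 1) ℝ).symm
      (Literature.Analysis.FunctionSpaces.gaussianSchwartz (EuclideanSpace ℝ (Fin 1)) 1) with hGr
  set Gc : SchwartzMap (Fin 1 → ℂ) ℂ :=
    SchwartzMap.compCLMOfContinuousLinearEquiv ℝ (PiLp.continuousLinearEquiv 2 ℝ (fun _ : Fin 1 => ℂ)).symm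
      (Literature.Analysis.FunctionSpaces.gaussianSchwartz (EuclideanSpace ℂ (Fin 1)) 1) with hGc
  have hGr_apply : ∀ x : Fin 1 → ℝ, ∃ t : ℝ, Gr x = ((Real.exp t : ℝ) : ℂ) := fun x =>
    ⟨_, by rw [hGr, SchwartzMap.compCLMOfContinuousLinearEquiv_apply, Function.comp_apply,
      Literature.Analysis.FunctionSpaces.gaussianSchwartz_apply one_pos]⟩
  have hGc_apply : ∀ z : Fin 1 → ℂ, ∃ t : ℝ, Gc z = ((Real.exp t : ℝ) : ℂ) := fun z =>
    ⟨_, by rw [hGc, SchwartzMap.compCLMOfContinuousLinearEquiv_apply, Function.comp_apply,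
      Literature.Analysis.FunctionSpaces.gaussianSchwartz_apply one_pos]⟩
  -- the archimedean product is a positive real number
  have harch : ∀ y : Fin 1 → mixedEmbedding.mixedSpace K, ∃ r : ℝ, 0 < r ∧
      archSchwartzFun K 1 (fun _ => Gr) (fun _ => Gc) y = (r : ℂ) := by
    intro y
    choose tr htr using fun w : {w : InfinitePlace K // w.IsReal} => hGr_apply fun i => (y i).1 w
    choose tc htc using fun w : {w : InfinitePlace K // w.IsComplex} => hGc_apply fun i => (y i).2 w
    refine ⟨(∏ w, Real.exp (tr w)) * ∏ w, Real.exp (tc w),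
      mul_pos (Finset.prod_pos fun w _ => Real.exp_pos _) (Finset.prod_pos fun w _ => Real.exp_pos _), ?_⟩
    rw [archSchwartzFun, Complex.ofReal_mul, Complex.ofReal_prod, Complex.ofReal_prod]
    congr 1
    · exact Finset.prod_congr rfl fun w _ => htr w
    · exact Finset.prod_congr rfl fun w _ => htc w
  set Φ₀ : (Fin 1 → AdeleRing (𝓞 K) K) → ℂ := fun x =>
    archSchwartzFun K 1 (fun _ => Gr) (fun _ => Gc) (vecInfinitePart K 1 x) * U.indicator 1 (vecFinitePart K 1 x)
    with hΦ₀
  have hstd : IsStandardSchwartzBruhat K 1 Φ₀ := isStandardSchwartzBruhat_mul_indicator (fun _ => Gr) (fun _ => Gc) hUcl hUc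
  -- values: `r > 0` on the box, `0` off it
  have hval : ∀ x, ∃ r : ℝ, 0 < r ∧ (Φ₀ x = (r : ℂ) ∧ vecFinitePart K 1 x ∈ U ∨ Φ₀ x = 0 ∧ vecFinitePart K 1 x ∉ U) := by
    intro x
    obtain ⟨r, hr, hre⟩ := harch (vecInfinitePart K 1 x)
    refine ⟨r, hr, ?_⟩
    by_cases hx : vecFinitePart K 1 x ∈ U
    · left
      refine ⟨?_, hx⟩
      rw [hΦ₀]
      dsimp only
      rw [hre, Set.indicator_of_mem hx, Pi.one_apply, mul_one]
    · right
      refine ⟨?_, hx⟩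
      rw [hΦ₀]
      dsimp only
      rw [Set.indicator_of_notMem hx, mul_zero]
  refine ⟨Φ₀, hstd.mem_adelicSchwartzBruhat, fun x => ?_, ?_⟩
  · obtain ⟨r, hr, (⟨h, -⟩ | ⟨h, -⟩)⟩ := hval x
    · rw [h]; exact ⟨Complex.ofReal_im r, by rw [Complex.ofReal_re]; exact hr.le⟩
    · rw [h]; exact ⟨Complex.zero_im, le_of_eq Complex.zero_re.symm⟩
  -- the lower bound on `C`: continuity of `Φ₀` on the compact `C`, positivity pointwise there
  by_cases hCne : C.Nonempty
  · have hcont : Continuous fun x : AdeleRing (𝓞 K) K => (Φ₀ fun _ => x).re :=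
      Complex.continuous_re.comp (hstd.continuous.comp (continuous_pi fun _ => continuous_id))
    obtain ⟨x₀, hx₀, hmin⟩ := hC.exists_isMinOn hCne hcont.continuousOn
    have hpos : ∀ x ∈ C, 0 < (Φ₀ fun _ => x).re := by
      intro x hx
      obtain ⟨r, hr, (⟨h, -⟩ | ⟨-, hnot⟩)⟩ := hval (fun _ => x)
      · rw [h, Complex.ofReal_re]; exact hr
      · exact absurd (hCU ⟨x, hx, rfl⟩) hnot
    exact ⟨(Φ₀ fun _ => x₀).re, hpos x₀ hx₀, fun x hx => hmin hx⟩
  · refine ⟨1, one_pos, fun x hx => absurd ⟨x, hx⟩ hCne⟩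

/-! ## §2 Domination of a compactly supported continuous function -/

variable {K}

/-- **A continuous compactly supported `Ψ` on `𝔸_K` is dominated by a Schwartz–Bruhat function**:
`‖Ψ x‖ ≤ re Φ₀(x)` for some real non-negative `Φ₀ ∈ 𝒮(𝔸_K¹)` (§1 on the support, scaled by `sup ‖Ψ‖ / m`).
[cite: Bump1997, §3.1] [cite: CasselsFrohlichANT1967, Ch. XV §4.4] -/
theorem exists_adelicSchwartzBruhat_norm_le {V : Type*} [NormedAddCommGroup V] {Ψ : AdeleRing (𝓞 K) K → V}
    (hΨc : Continuous Ψ) (hΨ : HasCompactSupport Ψ) :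
    ∃ Φ₀ : (Fin 1 → AdeleRing (𝓞 K) K) → ℂ, Φ₀ ∈ adelicSchwartzBruhat K 1 ∧
      (∀ x, (Φ₀ x).im = 0 ∧ 0 ≤ (Φ₀ x).re) ∧ ∀ x, ‖Ψ x‖ ≤ (Φ₀ fun _ => x).re := by
  obtain ⟨Φ₀, hΦ₀, hre, m, hm, hmin⟩ := exists_adelicSchwartzBruhat_re_pos_on K hΨ.isCompact
  obtain ⟨B, hB⟩ := hΨc.bounded_above_of_compact_support hΨ
  have hB0 : 0 ≤ B := (norm_nonneg _).trans (hB 0)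
  refine ⟨(((B / m : ℝ) : ℂ)) • Φ₀, Submodule.smul_mem _ _ hΦ₀, fun x => ?_, fun x => ?_⟩
  · rw [Pi.smul_apply, smul_eq_mul, Complex.re_ofReal_mul, Complex.im_ofReal_mul, (hre x).1, mul_zero]
    exact ⟨rfl, mul_nonneg (div_nonneg hB0 hm.le) (hre x).2⟩
  · rw [Pi.smul_apply, smul_eq_mul, Complex.re_ofReal_mul]
    by_cases hx : x ∈ tsupport Ψ
    · calc ‖Ψ x‖ ≤ B := hB x
        _ = B / m * m := by rw [div_mul_cancel₀ B hm.ne']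
        _ ≤ B / m * (Φ₀ fun _ => x).re := by gcongr; exact hmin x hx
    · rw [image_eq_zero_of_notMem_tsupport hx, norm_zero]
      exact mul_nonneg (div_nonneg hB0 hm.le) (hre _).2

/-! ## §3 Tate's absolute convergence at `n = 1` -/

variable (K)
variable [MeasurableSpace (AdeleRing (𝓞 K) K)] [BorelSpace (AdeleRing (𝓞 K) K)]

/-- **Tate's absolute convergence for `𝒮(𝔸_K)` at `σ > 1`, one variable**: for `Φ ∈ 𝒮(𝔸_K¹)`, a Haar measure `ν` on `𝕀_K`
and `σ > 1`, `∫⁻ ‖Φ(a)‖ ‖a‖^σ dν(a) < ∞` — the `n = 1` case of the mirabolic majorant ★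
`continuous_and_tsum_lintegral_lt_top_of_mem` (`ℙ⁰(K)` is one point `[ξ]`; take `g = (ξ⁻¹)` so that `ξ g = 1`).
[cite: CasselsFrohlichANT1967, Ch. XV Lemma 4.4.3] [cite: Bump1997, Prop. 3.1.8] -/
theorem lintegral_enorm_adelicSchwartzBruhat_mul_rpow_lt_top (ν : Measure (GaloisRepresentations.ideleGroup K))
    [ν.IsHaarMeasure] {Φ : (Fin 1 → AdeleRing (𝓞 K) K) → ℂ} (hΦ : Φ ∈ adelicSchwartzBruhat K 1) {σ : ℝ} (hσ : 1 < σ) :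
    ∫⁻ a, ‖Φ fun _ => (a : AdeleRing (𝓞 K) K)‖ₑ *
        ENNReal.ofReal ((IdeleClassGroup.ideleNorm K a : ℝ) ^ σ) ∂ν < ⊤ := by
  classical
  -- the unique point of `ℙ⁰(K)` and a unit representative `a₀ • 1`
  have h1 : (fun _ : Fin 1 => (1 : K)) ≠ 0 := fun h => one_ne_zero (congr_fun h 0)
  set p₀ : Projectivization K (Fin 1 → K) := Projectivization.mk K (fun _ => (1 : K)) h1 with hp₀
  obtain ⟨a₀, ha₀⟩ := Projectivization.exists_smul_eq_mk_rep K (fun _ : Fin 1 => (1 : K)) h1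
  have hrep : ratVec K p₀.rep = fun _ => algebraMap K (AdeleRing (𝓞 K) K) (a₀ : K) := by
    funext i
    rw [ratVec, hp₀, ← ha₀, Pi.smul_apply, Units.smul_def, smul_eq_mul, mul_one]
  -- `g = (a₀⁻¹)` as an element of `GL₁(𝔸_K)`
  set u : (AdeleRing (𝓞 K) K)ˣ := Units.map (algebraMap K (AdeleRing (𝓞 K) K)).toMonoidHom a₀⁻¹ with hu
  have hu' : (u : AdeleRing (𝓞 K) K) = algebraMap K (AdeleRing (𝓞 K) K) (((a₀⁻¹ : Kˣ)) : K) := rfl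
  set g : GL (Fin 1) (AdeleRing (𝓞 K) K) :=
    ⟨Matrix.diagonal fun _ => (u : AdeleRing (𝓞 K) K), Matrix.diagonal fun _ => ((u⁻¹ : (AdeleRing (𝓞 K) K)ˣ) : _),
      by rw [Matrix.diagonal_mul_diagonal]; simp, by rw [Matrix.diagonal_mul_diagonal]; simp⟩ with hg
  have hvec : ratVec K p₀.rep ᵥ* (g : Matrix (Fin 1) (Fin 1) (AdeleRing (𝓞 K) K)) = fun _ => 1 := by
    rw [hrep]
    funext i
    change ((fun _ => algebraMap K (AdeleRing (𝓞 K) K) (a₀ : K)) ᵥ* Matrix.diagonal fun _ => (u : AdeleRing (𝓞 K) K)) i = 1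
    rw [Matrix.vecMul_diagonal, hu', ← map_mul, Units.mul_inv, map_one]
  have hT := ((continuous_and_tsum_lintegral_lt_top_of_mem K ν hΦ).2 σ hσ g).ne
  have hle := ENNReal.le_tsum (f := fun p : Projectivization K (Fin 1 → K) =>
    ∫⁻ a, (‖Φ ((a : AdeleRing (𝓞 K) K) •
        (ratVec K p.rep ᵥ* (g : Matrix (Fin 1) (Fin 1) (AdeleRing (𝓞 K) K))))‖ₑ : ℝ≥0∞) *
      ENNReal.ofReal ((IdeleClassGroup.ideleNorm K a : ℝ) ^ (((1 : ℕ) : ℝ) * σ)) ∂ν) p₀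
  refine lt_of_le_of_lt (le_of_eq ?_) (lt_of_le_of_lt hle (lt_top_iff_ne_top.2 hT))
  refine lintegral_congr fun a => ?_
  have hsm : ((a : AdeleRing (𝓞 K) K) • fun _ : Fin 1 => (1 : AdeleRing (𝓞 K) K)) = fun _ => (a : AdeleRing (𝓞 K) K) := by
    funext i
    rw [Pi.smul_apply, smul_eq_mul, mul_one]
  rw [hvec, Nat.cast_one, one_mul, hsm]

/-! ## §4 The heads -/

/-- **`∫⁻_{𝕀_K} ‖Ψ(a)‖ ‖a‖^σ dν(a) < ∞`** for a continuous compactly supported `Ψ` on `𝔸_K`, a Haar measure `ν` on `𝕀_K`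
and `σ > 1` (§2 domination + §3). [cite: CasselsFrohlichANT1967, Ch. XV Lemma 4.4.3] [cite: Bump1997, Prop. 3.1.8] -/
theorem lintegral_enorm_mul_ideleNorm_rpow_lt_top (ν : Measure (GaloisRepresentations.ideleGroup K)) [ν.IsHaarMeasure]
    {V : Type*} [NormedAddCommGroup V] {Ψ : AdeleRing (𝓞 K) K → V} (hΨc : Continuous Ψ) (hΨ : HasCompactSupport Ψ)
    {σ : ℝ} (hσ : 1 < σ) :
    ∫⁻ a, ‖Ψ (a : AdeleRing (𝓞 K) K)‖ₑ * ENNReal.ofReal ((IdeleClassGroup.ideleNorm K a : ℝ) ^ σ) ∂ν < ⊤ := by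
  obtain ⟨Φ₀, hΦ₀, hre, hdom⟩ := exists_adelicSchwartzBruhat_norm_le hΨc hΨ
  have hpt : ∀ a : GaloisRepresentations.ideleGroup K,
      ‖Ψ (a : AdeleRing (𝓞 K) K)‖ₑ ≤ ‖Φ₀ fun _ => (a : AdeleRing (𝓞 K) K)‖ₑ := by
    intro a
    rw [← ofReal_norm, ← ofReal_norm]
    exact ENNReal.ofReal_le_ofReal ((hdom _).trans (Complex.re_le_norm _))
  exact lt_of_le_of_lt (lintegral_mono fun a => by gcongr; exact hpt a)
    (lintegral_enorm_adelicSchwartzBruhat_mul_rpow_lt_top K ν hΦ₀ hσ)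

/-- **The inverted Lebesgue form: `∫⁻_{𝕀_K} ‖Ψ(a⁻¹)‖ ‖a‖^{−σ} dν(a) < ∞`** (inversion invariance of the Haar measure of the
commutative group `𝕀_K`, `‖a⁻¹‖ = ‖a‖⁻¹`). [cite: CasselsFrohlichANT1967, Ch. XV Thm. 4.4.1 (proof)] -/
theorem lintegral_enorm_comp_inv_mul_ideleNorm_rpow_neg_lt_top (ν : Measure (GaloisRepresentations.ideleGroup K))
    [ν.IsHaarMeasure] {V : Type*} [NormedAddCommGroup V] {Ψ : AdeleRing (𝓞 K) K → V} (hΨc : Continuous Ψ)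
    (hΨ : HasCompactSupport Ψ) {σ : ℝ} (hσ : 1 < σ) :
    ∫⁻ a, ‖Ψ (((a⁻¹ : GaloisRepresentations.ideleGroup K)) : AdeleRing (𝓞 K) K)‖ₑ *
        ENNReal.ofReal ((IdeleClassGroup.ideleNorm K a : ℝ) ^ (-σ)) ∂ν < ⊤ := by
  haveI := borelSpace_ideleGroup K
  haveI := locallyCompactSpace_ideleGroup K
  haveI := secondCountableTopology_ideleGroup K
  haveI := t2Space_ideleGroup K
  have h := lintegral_enorm_mul_ideleNorm_rpow_lt_top K ν hΨc hΨ hσ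
  rw [← lintegral_inv_eq_self (fun a : GaloisRepresentations.ideleGroup K =>
    ‖Ψ (a : AdeleRing (𝓞 K) K)‖ₑ * ENNReal.ofReal ((IdeleClassGroup.ideleNorm K a : ℝ) ^ σ))] at h
  refine lt_of_le_of_lt (le_of_eq (lintegral_congr fun a => ?_)) h
  simp only [map_inv, NNReal.coe_inv, Real.inv_rpow (NNReal.coe_nonneg _), Real.rpow_neg (NNReal.coe_nonneg _)]

/-- **`a ↦ ‖a‖^σ • Ψ(a)` is integrable on `𝕀_K`** (`Ψ` continuous with compact support on `𝔸_K`, `ν` Haar, `σ > 1`).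
[cite: CasselsFrohlichANT1967, Ch. XV Lemma 4.4.3] [cite: Bump1997, Prop. 3.1.8] -/
theorem integrable_ideleNorm_rpow_smul (ν : Measure (GaloisRepresentations.ideleGroup K)) [ν.IsHaarMeasure]
    {V : Type*} [NormedAddCommGroup V] [NormedSpace ℝ V] {Ψ : AdeleRing (𝓞 K) K → V} (hΨc : Continuous Ψ)
    (hΨ : HasCompactSupport Ψ) {σ : ℝ} (hσ : 1 < σ) :
    Integrable (fun a : GaloisRepresentations.ideleGroup K =>
      ((IdeleClassGroup.ideleNorm K a : ℝ) ^ σ) • Ψ (a : AdeleRing (𝓞 K) K)) ν := by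
  haveI := borelSpace_ideleGroup K
  haveI := secondCountableTopology_ideleGroup K
  have hnc : Continuous fun a : GaloisRepresentations.ideleGroup K => ((IdeleClassGroup.ideleNorm K a : ℝ) ^ σ) :=
    (NNReal.continuous_coe.comp (continuous_ideleNorm_holds K)).rpow_const fun _ => Or.inr (zero_le_one.trans hσ.le)
  have hm : AEStronglyMeasurable (fun a : GaloisRepresentations.ideleGroup K =>
      ((IdeleClassGroup.ideleNorm K a : ℝ) ^ σ) • Ψ (a : AdeleRing (𝓞 K) K)) ν :=
    (hnc.smul (hΨc.comp Units.continuous_val)).aestronglyMeasurable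
  refine ⟨hm, ?_⟩
  have h := lintegral_enorm_mul_ideleNorm_rpow_lt_top K ν hΨc hΨ hσ
  refine lt_of_le_of_lt (lintegral_mono fun a => le_of_eq ?_) h
  rw [enorm_smul, mul_comm, Real.enorm_eq_ofReal (Real.rpow_nonneg (NNReal.coe_nonneg _) _)]

/-- **The inverted form: `a ↦ ‖a‖^{−σ} • Ψ(a⁻¹)` is integrable on `𝕀_K`** — a Haar measure on the commutative group `𝕀_K`
is inversion invariant, and `‖a⁻¹‖^σ = ‖a‖^{−σ}` (Tate's substitution `𝔞 ↦ 𝔞⁻¹`).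
[cite: CasselsFrohlichANT1967, Ch. XV Thm. 4.4.1 (proof)] -/
theorem integrable_ideleNorm_rpow_neg_smul_comp_inv (ν : Measure (GaloisRepresentations.ideleGroup K)) [ν.IsHaarMeasure]
    {V : Type*} [NormedAddCommGroup V] [NormedSpace ℝ V] {Ψ : AdeleRing (𝓞 K) K → V} (hΨc : Continuous Ψ)
    (hΨ : HasCompactSupport Ψ) {σ : ℝ} (hσ : 1 < σ) :
    Integrable (fun a : GaloisRepresentations.ideleGroup K =>
      ((IdeleClassGroup.ideleNorm K a : ℝ) ^ (-σ)) • Ψ (((a⁻¹ : GaloisRepresentations.ideleGroup K)) : AdeleRing (𝓞 K) K)) ν := by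
  haveI := borelSpace_ideleGroup K
  haveI := locallyCompactSpace_ideleGroup K
  haveI := secondCountableTopology_ideleGroup K
  haveI := t2Space_ideleGroup K
  have h := (integrable_ideleNorm_rpow_smul K ν hΨc hΨ hσ).comp_inv
  refine h.congr (ae_of_all _ fun a => ?_)
  simp only [map_inv, NNReal.coe_inv, Real.inv_rpow (NNReal.coe_nonneg _), Real.rpow_neg (NNReal.coe_nonneg _)]

end Literature.NumberTheory.Automorphic

end
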